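import Mathlib.Analysis.SpecialFunctions.SmoothTransition
import Mathlib.Analysis.InnerProductSpace.PiL2
import Mathlib.Analysis.Calculus.Deriv.Mul
import Mathlib.Analysis.Calculus.Deriv.Add
import Mathlib.Analysis.Calculus.Deriv.Prod
import Mathlib.Analysis.Calculus.ContDiff.Basic
import Mathlib.Topology.MetricSpace.Basic
import HarnessLib

/-!
# The lifted two-arc family: two planar arcs joined through embedded space arcs

Topic `Literature/Topology/FourManifolds`. Pure real analysis for the fact seat
`provefact-Literature.Topology.FourManifolds.BandData.exists_ambientIsotopy_of_band_eq_of_isRegular`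
(`BandSumIsotopyRegular.lean`). Everything here is proved; no named facts are introduced.

**The device.** Two embedded planar arcs `x, x' : [t₀, t₁] → ℝ²` with the same endpoints are in
general *not* isotopic in the plane by an elementary formula (this is the planar two-arc lemma,
a Schoenflies-type statement). In a *thickened* plane `ℝ² × ℝ`, however, the straight-line homotopy
`X_u = (1 - u) x + u x'` lifted by a height which is a strictly monotone function of the parameter
on the middle of the window,
`Z_u (t) = c u (1 - u) ζ(t)`, `ζ(t) = χ(t) (t - m)` (`χ` a plateau function, `m` the midpoint),
is a family of **embedded** space arcs from `(x, 0)` to `(x', 0)`: on the middle zone two parameters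
with the same image have the same height, hence are equal; near the two ends of the window both
arcs are graphs over the second coordinate `x₁` with the *same* `x₁`-parametrisation (so `X_u` is
such a graph too); and a parameter near an end and a parameter in the middle have planar images at
different distances from the endpoint. This file proves exactly this (`injOn_liftFam`) together with
the regularity of the stages (`deriv_liftFam_ne_zero`) and elementary bounds; the band-sum assembly
feeds it with the planar tracks of the two band sums read in a thickening of the band.

* `plateau t₀ t₁ κ₀ κ₁` — smooth, `= 0` off `(t₀ + κ₀, t₁ - κ₀)`, `= 1` on `[t₀ + κ₁, t₁ - κ₁]`,
  values in `[0, 1]`; `liftBump t₀ t₁ κ₀ κ₁ t = plateau … t * (t - (t₀ + t₁)/2)`.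
* `famX x x' u t = (1 - u) • x t + u • x' t`, `famZ ζ c e u t = (c * (u * (1 - u)) * ζ t) • e`,
  `liftFam x x' ζ c e u t = (famX x x' u t, famZ ζ c e u t)`.
* `injOn_liftFam` — injectivity of every stage `u ∈ [0, 1]` on the window from the zone hypotheses;
  `deriv_liftFam_ne_zero` — regularity; `norm_famZ_le` — the height bound `|c| · B / 4 · ‖e‖` for
  `|ζ| ≤ B` (with `abs_liftBump_le`: `B = (t₁ - t₀) / 2` on the window).

## References

* M. W. Hirsch, *Differential Topology* (1976), Ch. 8 §1 (isotopies of embeddings; the band-sum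
  application is Exercise-level folklore: arcs on a surface in a 3-manifold can be separated
  through the normal direction). [HirschDT1976]

## Design notes

* Statements are over `EuclideanSpace ℝ (Fin 2)` and an arbitrary real normed space `F` for the
  height (the assembly uses `EuclideanSpace ℝ (Fin 1)`), with the window `[t₀, t₁]` and margins
  `κ` explicit. Nothing here uses `sorry`.
-/

open Function Set Metric Filter
open scoped ContDiff Topology

noncomputable section

namespace Literature.Topology.FourManifolds

/-- Local notation: `𝔼 n` is the model Euclidean space `EuclideanSpace ℝ (Fin n)`. -/
local notation "𝔼 " n:arg => EuclideanSpace ℝ (Fin n)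

/-! ## Plateau functions and the height profile -/

/-- The **plateau function** of the window `[t₀, t₁]` with margins `κ₀ < κ₁`: a product of two
smooth steps, rising on `[t₀ + κ₀, t₀ + κ₁]` and falling on `[t₁ - κ₁, t₁ - κ₀]`. [folklore] -/
def plateau (t₀ t₁ κ₀ κ₁ : ℝ) (t : ℝ) : ℝ :=
  Real.smoothTransition ((t - (t₀ + κ₀)) / (κ₁ - κ₀)) * Real.smoothTransition ((t₁ - κ₀ - t) / (κ₁ - κ₀))

/-- The plateau function is smooth. [folklore] -/
theorem contDiff_plateau (t₀ t₁ κ₀ κ₁ : ℝ) : ContDiff ℝ ∞ (plateau t₀ t₁ κ₀ κ₁) := by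
  unfold plateau
  exact (Real.smoothTransition.contDiff.comp ((contDiff_id.sub contDiff_const).div_const _)).mul
    (Real.smoothTransition.contDiff.comp ((contDiff_const.sub contDiff_id).div_const _))

/-- The plateau function takes values in `[0, 1]`. [folklore] -/
theorem plateau_mem_Icc (t₀ t₁ κ₀ κ₁ t : ℝ) : plateau t₀ t₁ κ₀ κ₁ t ∈ Icc (0 : ℝ) 1 := by
  unfold plateau
  refine ⟨mul_nonneg (Real.smoothTransition.nonneg _) (Real.smoothTransition.nonneg _), ?_⟩
  calc _ ≤ 1 * 1 := mul_le_mul (Real.smoothTransition.le_one _) (Real.smoothTransition.le_one _)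
        (Real.smoothTransition.nonneg _) zero_le_one
    _ = 1 := one_mul 1

/-- Left of `t₀ + κ₀` the plateau vanishes. [folklore] -/
theorem plateau_eq_zero_of_le {t₀ t₁ κ₀ κ₁ t : ℝ} (hκ : κ₀ < κ₁) (ht : t ≤ t₀ + κ₀) :
    plateau t₀ t₁ κ₀ κ₁ t = 0 := by
  unfold plateau
  rw [Real.smoothTransition.zero_of_nonpos (div_nonpos_of_nonpos_of_nonneg (by linarith) (by linarith)),
    zero_mul]

/-- Right of `t₁ - κ₀` the plateau vanishes. [folklore] -/
theorem plateau_eq_zero_of_ge {t₀ t₁ κ₀ κ₁ t : ℝ} (hκ : κ₀ < κ₁) (ht : t₁ - κ₀ ≤ t) :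
    plateau t₀ t₁ κ₀ κ₁ t = 0 := by
  unfold plateau
  rw [Real.smoothTransition.zero_of_nonpos (x := (t₁ - κ₀ - t) / (κ₁ - κ₀))
    (div_nonpos_of_nonpos_of_nonneg (by linarith) (by linarith)), mul_zero]

/-- On `[t₀ + κ₁, t₁ - κ₁]` the plateau is `1`. [folklore] -/
theorem plateau_eq_one {t₀ t₁ κ₀ κ₁ t : ℝ} (hκ : κ₀ < κ₁) (ht : t ∈ Icc (t₀ + κ₁) (t₁ - κ₁)) :
    plateau t₀ t₁ κ₀ κ₁ t = 1 := by
  unfold plateau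
  rw [Real.smoothTransition.one_of_one_le, Real.smoothTransition.one_of_one_le, one_mul]
  · rw [le_div_iff₀ (by linarith)]; linarith [ht.2]
  · rw [le_div_iff₀ (by linarith)]; linarith [ht.1]

/-- Near a point of the open plateau `(t₀ + κ₁, t₁ - κ₁)` the plateau function is eventually `1`.
[folklore] -/
theorem plateau_eventuallyEq_one {t₀ t₁ κ₀ κ₁ t : ℝ} (hκ : κ₀ < κ₁) (ht : t ∈ Ioo (t₀ + κ₁) (t₁ - κ₁)) :
    plateau t₀ t₁ κ₀ κ₁ =ᶠ[𝓝 t] fun _ ↦ 1 := by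
  filter_upwards [Ioo_mem_nhds ht.1 ht.2] with s hs using plateau_eq_one hκ (Ioo_subset_Icc_self hs)

/-- The **height profile** `ζ (t) = plateau (t) · (t - m)`, `m` the midpoint of the window: zero
near the ends of the window, the signed distance from the midpoint on the plateau. [folklore] -/
def liftBump (t₀ t₁ κ₀ κ₁ : ℝ) (t : ℝ) : ℝ := plateau t₀ t₁ κ₀ κ₁ t * (t - (t₀ + t₁) / 2)

/-- The height profile is smooth. [folklore] -/
theorem contDiff_liftBump (t₀ t₁ κ₀ κ₁ : ℝ) : ContDiff ℝ ∞ (liftBump t₀ t₁ κ₀ κ₁) :=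
  (contDiff_plateau t₀ t₁ κ₀ κ₁).mul (contDiff_id.sub contDiff_const)

/-- Left of `t₀ + κ₀` the height profile vanishes. [folklore] -/
theorem liftBump_eq_zero_of_le {t₀ t₁ κ₀ κ₁ t : ℝ} (hκ : κ₀ < κ₁) (ht : t ≤ t₀ + κ₀) :
    liftBump t₀ t₁ κ₀ κ₁ t = 0 := by
  rw [liftBump, plateau_eq_zero_of_le hκ ht, zero_mul]

/-- Right of `t₁ - κ₀` the height profile vanishes. [folklore] -/
theorem liftBump_eq_zero_of_ge {t₀ t₁ κ₀ κ₁ t : ℝ} (hκ : κ₀ < κ₁) (ht : t₁ - κ₀ ≤ t) :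
    liftBump t₀ t₁ κ₀ κ₁ t = 0 := by
  rw [liftBump, plateau_eq_zero_of_ge hκ ht, zero_mul]

/-- On the plateau the height profile is `t - m`. [folklore] -/
theorem liftBump_eq_of_mem {t₀ t₁ κ₀ κ₁ t : ℝ} (hκ : κ₀ < κ₁) (ht : t ∈ Icc (t₀ + κ₁) (t₁ - κ₁)) :
    liftBump t₀ t₁ κ₀ κ₁ t = t - (t₀ + t₁) / 2 := by
  rw [liftBump, plateau_eq_one hκ ht, one_mul]

/-- The height profile is strictly increasing on the plateau. [folklore] -/
theorem strictMonoOn_liftBump {t₀ t₁ κ₀ κ₁ : ℝ} (hκ : κ₀ < κ₁) :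
    StrictMonoOn (liftBump t₀ t₁ κ₀ κ₁) (Icc (t₀ + κ₁) (t₁ - κ₁)) := by
  intro s hs t ht hst
  rw [liftBump_eq_of_mem hκ hs, liftBump_eq_of_mem hκ ht]
  linarith

/-- On the open plateau the height profile has derivative `1`. [folklore] -/
theorem hasDerivAt_liftBump {t₀ t₁ κ₀ κ₁ t : ℝ} (hκ : κ₀ < κ₁) (ht : t ∈ Ioo (t₀ + κ₁) (t₁ - κ₁)) :
    HasDerivAt (liftBump t₀ t₁ κ₀ κ₁) 1 t := by
  have h : (fun s ↦ s - (t₀ + t₁) / 2) =ᶠ[𝓝 t] liftBump t₀ t₁ κ₀ κ₁ := by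
    filter_upwards [Ioo_mem_nhds ht.1 ht.2] with s hs
    rw [liftBump_eq_of_mem hκ (Ioo_subset_Icc_self hs)]
  exact ((hasDerivAt_id t).sub_const _).congr_of_eventuallyEq h.symm

/-- The height profile is bounded by half the window length on the window. [folklore] -/
theorem abs_liftBump_le {t₀ t₁ κ₀ κ₁ t : ℝ} (ht : t ∈ Icc t₀ t₁) :
    |liftBump t₀ t₁ κ₀ κ₁ t| ≤ (t₁ - t₀) / 2 := by
  rw [liftBump, abs_mul]
  have h1 : |plateau t₀ t₁ κ₀ κ₁ t| ≤ 1 := by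
    have := plateau_mem_Icc t₀ t₁ κ₀ κ₁ t
    rw [abs_of_nonneg this.1]; exact this.2
  have h2 : |t - (t₀ + t₁) / 2| ≤ (t₁ - t₀) / 2 := by
    rw [abs_le]; constructor <;> linarith [ht.1, ht.2]
  calc _ ≤ 1 * ((t₁ - t₀) / 2) := mul_le_mul h1 h2 (abs_nonneg _) zero_le_one
    _ = _ := one_mul _

/-! ## The family -/

section Family

variable {F : Type*} [NormedAddCommGroup F] [NormedSpace ℝ F]

/-- The planar straight-line homotopy `X_u = (1 - u) x + u x'`. [folklore] -/
def famX (x x' : ℝ → 𝔼 2) (u t : ℝ) : 𝔼 2 := (1 - u) • x t + u • x' t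

/-- The height `Z_u = c u (1 - u) ζ • e`. [folklore] -/
def famZ (ζ : ℝ → ℝ) (c : ℝ) (e : F) (u t : ℝ) : F := (c * (u * (1 - u)) * ζ t) • e

/-- The lifted family `(X_u, Z_u)`. [folklore] -/
def liftFam (x x' : ℝ → 𝔼 2) (ζ : ℝ → ℝ) (c : ℝ) (e : F) (u t : ℝ) : (𝔼 2) × F :=
  (famX x x' u t, famZ ζ c e u t)

variable {x x' : ℝ → 𝔼 2} {ζ : ℝ → ℝ} {c : ℝ} {e : F}

/-- First component of the lifted family. [folklore] -/
@[simp] theorem liftFam_fst (u t : ℝ) : (liftFam x x' ζ c e u t).1 = famX x x' u t := rfl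

/-- Second component of the lifted family. [folklore] -/
@[simp] theorem liftFam_snd (u t : ℝ) : (liftFam x x' ζ c e u t).2 = famZ ζ c e u t := rfl

/-- At `u = 0` the planar homotopy is `x`. [folklore] -/
@[simp] theorem famX_zero (t : ℝ) : famX x x' 0 t = x t := by simp [famX]

/-- At `u = 1` the planar homotopy is `x'`. [folklore] -/
@[simp] theorem famX_one (t : ℝ) : famX x x' 1 t = x' t := by simp [famX]

/-- Where the two arcs agree the planar homotopy is constant. [folklore] -/
theorem famX_eq_of_eq {u t : ℝ} (h : x' t = x t) : famX x x' u t = x t := by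
  rw [famX, h, ← add_smul]; ring_nf; exact one_smul _ _

/-- A coordinate of the planar homotopy is the homotopy of the coordinates. [folklore] -/
theorem famX_apply (u t : ℝ) (i : Fin 2) : famX x x' u t i = (1 - u) * x t i + u * x' t i := by
  simp [famX]

/-- Where the second coordinates agree, the planar homotopy has that second coordinate.
[folklore] -/
theorem famX_apply_eq_of_eq {u t : ℝ} {i : Fin 2} (h : x' t i = x t i) : famX x x' u t i = x t i := by
  rw [famX_apply, h]; ring

/-- At `u = 0` the height vanishes. [folklore] -/
@[simp] theorem famZ_zero (t : ℝ) : famZ ζ c e 0 t = 0 := by simp [famZ]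

/-- At `u = 1` the height vanishes. [folklore] -/
@[simp] theorem famZ_one (t : ℝ) : famZ ζ c e 1 t = 0 := by simp [famZ]

/-- Where the profile vanishes the height vanishes. [folklore] -/
theorem famZ_eq_zero_of_eq_zero {u t : ℝ} (h : ζ t = 0) : famZ ζ c e u t = 0 := by simp [famZ, h]

/-- **Height bound**: `‖Z_u (t)‖ ≤ |c| · B / 4 · ‖e‖` when `|ζ| ≤ B` and `u ∈ [0, 1]`. [folklore] -/
theorem norm_famZ_le {u t B : ℝ} (hu : u ∈ Icc (0 : ℝ) 1) (hB : |ζ t| ≤ B) :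
    ‖famZ ζ c e u t‖ ≤ |c| * (B / 4) * ‖e‖ := by
  rw [famZ, norm_smul, Real.norm_eq_abs, abs_mul, abs_mul]
  have h1 : |u * (1 - u)| ≤ 1 / 4 := by
    rw [abs_of_nonneg (mul_nonneg hu.1 (by linarith [hu.2]))]
    nlinarith [sq_nonneg (u - 1 / 2)]
  have hB0 : 0 ≤ B := (abs_nonneg _).trans hB
  have : |c| * |u * (1 - u)| * |ζ t| ≤ |c| * (B / 4) :=
    calc |c| * |u * (1 - u)| * |ζ t| ≤ |c| * (1 / 4) * B := by gcongr
      _ = |c| * (B / 4) := by ring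
  exact mul_le_mul_of_nonneg_right this (norm_nonneg _)

/-- The planar homotopy lies on the segment between the two arcs. [folklore] -/
theorem famX_mem_segment {u : ℝ} (hu : u ∈ Icc (0 : ℝ) 1) (t : ℝ) : famX x x' u t ∈ segment ℝ (x t) (x' t) :=
  ⟨1 - u, u, by linarith [hu.2], hu.1, by ring, rfl⟩

/-! ### Injectivity of the stages on the window -/

/-- **Every stage of the lifted family is injective on the window** `[t₀, t₁]`, `u ∈ [0, 1]`, under
the zone hypotheses: (end zones) on `[t₀, α₃]` and on `[β₃, t₁]` the two arcs have the same second
coordinate, which is strictly monotone there; (middle zone) the profile `ζ` is strictly monotone on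
`[α₁, β₁]`, `α₁ < α₃`, `β₃ < β₁`, and `c ≠ 0`, `e ≠ 0`; the arcs `x`, `x'` themselves are injective
on the window; (separation) parameters in `[t₀, α₁]` have planar image within `ρ` of `A` and
parameters in `[α₃, t₁]` at distance `≥ ρ` from `A`, and symmetrically at `B` with `[β₁, t₁]` and
`[t₀, β₃]`. [folklore] -/
theorem injOn_liftFam {t₀ t₁ α₁ α₃ β₃ β₁ ρ ρ' : ℝ} {A B : 𝔼 2} (hc : c ≠ 0) (he : e ≠ 0)
    (hAeq : ∀ t ∈ Icc t₀ α₃, x' t 1 = x t 1) (hAmono : StrictMonoOn (fun t ↦ x t 1) (Icc t₀ α₃))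
    (hBeq : ∀ t ∈ Icc β₃ t₁, x' t 1 = x t 1) (hBmono : StrictAntiOn (fun t ↦ x t 1) (Icc β₃ t₁))
    (hζ : StrictMonoOn ζ (Icc α₁ β₁)) (hx : InjOn x (Icc t₀ t₁)) (hx' : InjOn x' (Icc t₀ t₁))
    (hAnear : ∀ u ∈ Icc (0 : ℝ) 1, ∀ t ∈ Icc t₀ α₁, dist (famX x x' u t) A < ρ)
    (hAfar : ∀ u ∈ Icc (0 : ℝ) 1, ∀ t ∈ Icc α₃ t₁, ρ ≤ dist (famX x x' u t) A)
    (hBnear : ∀ u ∈ Icc (0 : ℝ) 1, ∀ t ∈ Icc β₁ t₁, dist (famX x x' u t) B < ρ')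
    (hBfar : ∀ u ∈ Icc (0 : ℝ) 1, ∀ t ∈ Icc t₀ β₃, ρ' ≤ dist (famX x x' u t) B)
    {u : ℝ} (hu : u ∈ Icc (0 : ℝ) 1) : InjOn (liftFam x x' ζ c e u) (Icc t₀ t₁) := by
  -- it suffices to treat `s < t`
  suffices key : ∀ s ∈ Icc t₀ t₁, ∀ t ∈ Icc t₀ t₁, s < t → liftFam x x' ζ c e u s ≠ liftFam x x' ζ c e u t by
    intro s hs t ht hst
    rcases lt_trichotomy s t with h | h | h
    · exact absurd hst (key s hs t ht h)
    · exact h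
    · exact absurd hst.symm (key t ht s hs h)
  intro s hs t ht hlt heq
  have hX : famX x x' u s = famX x x' u t := congrArg Prod.fst heq
  have hZ : famZ ζ c e u s = famZ ζ c e u t := congrArg Prod.snd heq
  -- planar second coordinates on the end zones
  have hX1 : famX x x' u s 1 = famX x x' u t 1 := by rw [hX]
  by_cases htα : t ≤ α₃
  · -- both in the zone at `A`
    have hs' : s ∈ Icc t₀ α₃ := ⟨hs.1, hlt.le.trans htα⟩
    have ht' : t ∈ Icc t₀ α₃ := ⟨ht.1, htα⟩
    rw [famX_apply_eq_of_eq (hAeq s hs'), famX_apply_eq_of_eq (hAeq t ht')] at hX1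
    exact absurd hX1 (hAmono hs' ht' hlt).ne
  push Not at htα
  by_cases hsβ : β₃ ≤ s
  · -- both in the zone at `B`
    have hs' : s ∈ Icc β₃ t₁ := ⟨hsβ, hs.2⟩
    have ht' : t ∈ Icc β₃ t₁ := ⟨hsβ.trans hlt.le, ht.2⟩
    rw [famX_apply_eq_of_eq (hBeq s hs'), famX_apply_eq_of_eq (hBeq t ht')] at hX1
    exact absurd hX1 (hBmono hs' ht' hlt).ne'
  push Not at hsβ
  by_cases hmid : α₁ ≤ s ∧ t ≤ β₁
  · -- both in the middle zone
    have hs' : s ∈ Icc α₁ β₁ := ⟨hmid.1, hlt.le.trans hmid.2⟩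
    have ht' : t ∈ Icc α₁ β₁ := ⟨hmid.1.trans hlt.le, hmid.2⟩
    rcases hu.1.eq_or_lt with rfl | hu0
    · simp only [liftFam, famX_zero, famZ_zero, Prod.mk.injEq, and_true] at heq
      exact absurd (hx hs ht heq) hlt.ne
    rcases hu.2.eq_or_lt' with rfl | hu1
    · simp only [liftFam, famX_one, famZ_one, Prod.mk.injEq, and_true] at heq
      exact absurd (hx' hs ht heq) hlt.ne
    · have hcu : c * (u * (1 - u)) ≠ 0 := mul_ne_zero hc (mul_ne_zero hu0.ne' (by linarith))
      have hζeq : ζ s = ζ t := by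
        have h1 : (c * (u * (1 - u)) * ζ s) • e = (c * (u * (1 - u)) * ζ t) • e := hZ
        have h2 := smul_left_injective ℝ he h1
        exact mul_left_cancel₀ hcu h2
      exact absurd hζeq (hζ hs' ht' hlt).ne
  · -- separated pairs
    rw [not_and_or, not_le, not_le] at hmid
    rcases hmid with hsα | htβ
    · have h1 := hAnear u hu s ⟨hs.1, hsα.le⟩
      have h2 := hAfar u hu t ⟨htα.le, ht.2⟩
      rw [hX] at h1
      exact absurd h1 (not_lt.2 h2)
    · have h1 := hBnear u hu t ⟨htβ.le, ht.2⟩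
      have h2 := hBfar u hu s ⟨hs.1, hsβ.le⟩
      rw [← hX] at h1
      exact absurd h1 (not_lt.2 h2)

/-! ### Regularity of the stages on the window -/

/-- The derivative of the planar homotopy. [folklore] -/
theorem hasDerivAt_famX {u t : ℝ} {v v' : 𝔼 2} (hx : HasDerivAt x v t) (hx' : HasDerivAt x' v' t) :
    HasDerivAt (famX x x' u) ((1 - u) • v + u • v') t :=
  (hx.const_smul (1 - u)).add (hx'.const_smul u)

/-- The derivative of the height. [folklore] -/
theorem hasDerivAt_famZ {u t d : ℝ} (hζ : HasDerivAt ζ d t) :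
    HasDerivAt (famZ ζ c e u) ((c * (u * (1 - u)) * d) • e) t := by
  unfold famZ
  exact (hζ.const_mul _).smul_const e

/-- The derivative of the lifted family. [folklore] -/
theorem hasDerivAt_liftFam {u t d : ℝ} {v v' : 𝔼 2} (hx : HasDerivAt x v t) (hx' : HasDerivAt x' v' t)
    (hζ : HasDerivAt ζ d t) :
    HasDerivAt (liftFam x x' ζ c e u) ((1 - u) • v + u • v', (c * (u * (1 - u)) * d) • e) t :=
  (hasDerivAt_famX hx hx').prodMk (hasDerivAt_famZ hζ)

/-- **Every stage of the lifted family is regular on the window**, `u ∈ [0, 1]`: on the end zones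
`[t₀, α₃]` and `[β₃, t₁]` the second planar coordinates of both arcs have derivatives of the same
strict sign, so the planar velocity of the convex combination is nonzero; on the open middle
`(α₃', β₃')` (where `α₃' < α₃`, `β₃ < β₃'`, so that the three zones cover the window) the profile has
nonzero derivative, which serves for `0 < u < 1`, while for `u = 0` and `u = 1` the arcs `x`, `x'`
themselves are regular. [folklore] -/
theorem deriv_liftFam_ne_zero {t₀ t₁ α₃ α₃' β₃' β₃ : ℝ} (hc : c ≠ 0) (he : e ≠ 0)
    (hα : α₃' < α₃) (hβ : β₃ < β₃')
    (hxd : ∀ t ∈ Icc t₀ t₁, DifferentiableAt ℝ x t) (hxd' : ∀ t ∈ Icc t₀ t₁, DifferentiableAt ℝ x' t)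
    (hζd : ∀ t ∈ Icc t₀ t₁, DifferentiableAt ℝ ζ t)
    (hxr : ∀ t ∈ Icc t₀ t₁, deriv x t ≠ 0) (hxr' : ∀ t ∈ Icc t₀ t₁, deriv x' t ≠ 0)
    (hA : ∀ t ∈ Icc t₀ α₃, 0 < deriv x t 1 ∧ 0 < deriv x' t 1)
    (hB : ∀ t ∈ Icc β₃ t₁, deriv x t 1 < 0 ∧ deriv x' t 1 < 0)
    (hζ : ∀ t ∈ Ioo α₃' β₃', deriv ζ t ≠ 0)
    {u : ℝ} (hu : u ∈ Icc (0 : ℝ) 1) {t : ℝ} (ht : t ∈ Icc t₀ t₁) :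
    deriv (liftFam x x' ζ c e u) t ≠ 0 := by
  have hD := hasDerivAt_liftFam (u := u) (c := c) (e := e) (hxd t ht).hasDerivAt (hxd' t ht).hasDerivAt
    (hζd t ht).hasDerivAt
  rw [hD.deriv]
  intro h0
  rw [Prod.mk_eq_zero] at h0
  obtain ⟨h1, h2⟩ := h0
  -- the second planar coordinate of the planar velocity
  have h1' : (1 - u) * deriv x t 1 + u * deriv x' t 1 = 0 := by
    have := congrArg (fun w : 𝔼 2 ↦ w 1) h1
    simpa using this
  by_cases htα : t ≤ α₃
  · obtain ⟨ha, ha'⟩ := hA t ⟨ht.1, htα⟩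
    have : 0 < (1 - u) * deriv x t 1 + u * deriv x' t 1 := by
      rcases hu.1.eq_or_lt with rfl | hu0
      · simpa using ha
      · have : 0 ≤ (1 - u) * deriv x t 1 := mul_nonneg (by linarith [hu.2]) ha.le
        nlinarith
    linarith
  by_cases htβ : β₃ ≤ t
  · obtain ⟨hb, hb'⟩ := hB t ⟨htβ, ht.2⟩
    have : (1 - u) * deriv x t 1 + u * deriv x' t 1 < 0 := by
      rcases hu.1.eq_or_lt with rfl | hu0
      · simpa using hb
      · have : (1 - u) * deriv x t 1 ≤ 0 := mul_nonpos_of_nonneg_of_nonpos (by linarith [hu.2]) hb.le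
        nlinarith
    linarith
  push Not at htα htβ
  have htm : t ∈ Ioo α₃' β₃' := ⟨hα.trans htα, htβ.trans hβ⟩
  rcases hu.1.eq_or_lt with rfl | hu0
  · simp only [sub_zero, one_smul, zero_smul, add_zero] at h1
    exact hxr t ht h1
  rcases hu.2.eq_or_lt' with rfl | hu1
  · simp only [sub_self, zero_smul, one_smul, zero_add] at h1
    exact hxr' t ht h1
  · have hcu : c * (u * (1 - u)) * deriv ζ t ≠ 0 :=
      mul_ne_zero (mul_ne_zero hc (mul_ne_zero hu0.ne' (by linarith))) (hζ t htm)
    exact (smul_ne_zero hcu he) h2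

end Family

end Literature.Topology.FourManifolds
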